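import Mathlib
import HarnessLib
import Literature.Analysis.FluidPDE.LocalTypeIMorreyProofs
import Literature.Analysis.FluidPDE.SereginSverakPressureLocalTypeI
import Literature.Analysis.FluidPDE.SpaceTimeRescaling
import Literature.Analysis.FluidPDE.SuitableWeakRescaling
import Summits.NavierStokesRegularity.NavierStokesRegularity.Theses.StretchingWellBinding
import Summits.NavierStokesRegularity.NavierStokesRegularity.Theses.HalfHolderEnergy
import Summits.NavierStokesRegularity.NavierStokesRegularity.Theorems.StretchingWellBindingEnstrophyQuarterLawLocalTypeITools
import Summits.NavierStokesRegularity.NavierStokesRegularity.Theorems.HalfHolderEnergyHolderBridge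
import Summits.NavierStokesRegularity.NavierStokesRegularity.Theorems.StretchingWellBindingEnstrophyQuarterLawToEnergyHalfHolder
import Summits.NavierStokesRegularity.NavierStokesRegularity.Theorems.AdiabaticEddyFrozenEddyAxisymOffAxis

/-!
# Shelf 1574, line `sparse_sieve`: the window law implies uniform local Type I (stub S1 is implied
# by the crux)

Helper file (`--supports stmt-NavierStokesRegularity-1574 --as helper`). The CHARACTERISATION converse of
the line card `Cruxes/EnstrophyQuarterLaw/Lines/sparse_sieve.md` ("why this is the right cut: conversely
`EnergyHalfHolder ⇒ UniformLocalTypeI` — the `E`-part verbatim, the `A`-part by Albritton–Barker L. 2.6 /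
Seregin 2006"), kernel-checked:

* `energy_ball_le_of_window` — the `A`-part on the late slab `[T/2, T)`: the window law
  `∫_a^b ∫ |curl u|² ≤ K √(b − a)` gives `∫_{B(x,R)} |u(s)|² ≤ M R` for all `T/2 ≤ s < T`, all `x`, all
  `0 < R ≤ r₀`. PROOF: rescale to unit viscosity, `v(s,y) = ν⁻¹ u(ν⁻¹s, y)` (the tree's `stPull` /
  `IsSuitableWeakSolutionOn.stRescale`, Tao's pressure gauge `isSuitableWeakSolutionOn_gauge_of_classical`);
  on every backward cylinder of `v` of radius `r` the window law pays `E(r) ≤ K ν^{-3/2}` (div–curl +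
  change of variables), the energy pays the top-scale `A(r₁)` and the GLOBAL `L^{3/2}` budget of the
  gauged pressure (`lintegral_slab_gauged_pressure_lt_top`) pays the top-scale `D(r₁)`; Seregin's
  centre-uniform Morrey estimate (Seregin 2006 L. 2.1(a) = Albritton–Barker 2019 L. 2.6, tree
  `Seregin2020.scaledEnergies_bounded_of_cknE_le_unif`) then bounds `A(r)` for `r ≤ r₁/2` uniformly in the
  centre; un-zoom, and pass from a.e. times to every time by continuity (`setLIntegral_ball_sq_le_of_ae`).
* `uniformLocalTypeI_of_window` — `UniformLocalTypeI T u` (the Cruxes-local predicate of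
  `Lines/sparse_sieve.lean`, UNFOLDED VERBATIM) for every classical Leray–Hopf solution on `[0, T)` from a
  rapidly decaying datum obeying the window law (early times `s < T/2` by the sub-slab sup bound
  `bounded_subslab_of_lerayHopf`; the `E`-part is `LocalTypeI.dissipation_cylinder_le_of_window`).
* BY NAME: `uniformLocalTypeI_of_energyHalfHolder : EnergyHalfHolder → ⟨signature of stub_uniformLocalTypeI⟩`
  and `uniformLocalTypeI_of_enstrophyQuarterLaw : EnstrophyQuarterLaw → ⟨same⟩` (via the landed
  `energyHalfHolder_of_enstrophyQuarterLaw`). So the line's "OPEN, XL" stub S1 costs NOTHING beyond the crux: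
  `EnstrophyQuarterLaw ⇒ UniformLocalTypeI`, i.e. S1 is a no-loss cut.

HONEST FRAMING: conditional bookkeeping about ONE hypothetical blow-up; `EnergyHalfHolder` (25161) and
`EnstrophyQuarterLaw` (1574) stay OPEN, and nothing here bears on the regularity problem itself. No summit
statement is proved.

## References

* G. Seregin, *Estimates of suitable weak solutions to the Navier–Stokes equations in critical Morrey
  spaces*, J. Math. Sci. 143 (2007); arXiv:math/0607537, Lemma 2.1 (a).
* D. Albritton, T. Barker, J. Math. Fluid Mech. 21 (2019) = arXiv:1811.00502, Lemma 2.6.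
* L. Caffarelli, R. Kohn, L. Nirenberg, Comm. Pure Appl. Math. 35 (1982), §2.
-/

noncomputable section

-- the summit-side namespace repeats a component by design (D-0017)
set_option linter.dupNamespace false

namespace Summit.NavierStokesRegularity.NavierStokesRegularity.Theorems.EnstrophyQuarterLaw.LocalTypeI

open Set MeasureTheory Function Metric Filter Topology
open scoped ENNReal NNReal
open Literature.Analysis.FluidPDE

variable {ν T : ℝ} {u : ℝ → EuclideanSpace ℝ (Fin 3) → EuclideanSpace ℝ (Fin 3)}
  {p : ℝ → EuclideanSpace ℝ (Fin 3) → ℝ}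

/-! ### The `A`-part on the late slab, by Seregin's centre-uniform Morrey estimate -/

/-- **Window law ⇒ uniform scaled local energy on the late slab.** For a classical solution on `[0, T)`
(viscosity `ν > 0`), Leray–Hopf on `[0, T]`, with `∫_a^b ∫ |curl u|² ≤ K √(b − a)` (`0 ≤ a ≤ b ≤ T`,
`K ≥ 0`): there are `M, r₀ > 0` with `∫_{B(x,R)} |u(s)|² ≤ M R` for all `s ∈ [T/2, T)`, `x ∈ ℝ³`,
`0 < R ≤ r₀`. (Unit-viscosity rescaling `v(s,y) = ν⁻¹u(ν⁻¹s,y)` with Tao's pressure gauge; on cylinders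
`Q_r(τ, x)`, `r ≤ r₁ = min(1, √(νT/2))`, `r₁² ≤ τ ≤ νT`: `E ≤ K ν^{-3/2}` from the window law, top-scale
`A(r₁) ≤ A₀` from the energy, `D(r₁) ≤ D₀` from the global `L^{3/2}` budget of the gauged pressure;
Seregin 2006 L. 2.1(a) with centre-uniform constant; un-zoom; a.e. time → every time by continuity.)
[cite: Seregin2006, Lemma 2.1 (a) (arXiv:math/0607537 §2); AlbrittonBarker2019, Lemma 2.6] -/
theorem energy_ball_le_of_window (hν : 0 < ν) (hT : 0 < T)
    (hsol : IsClassicalNSSolutionOn (Ico 0 T) ν 0 u p) (hLH : IsLerayHopfOn T ν 0 (u 0) u)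
    {K : ℝ} (hK : 0 ≤ K)
    (hwin : ∀ a b : ℝ, 0 ≤ a → a ≤ b → b ≤ T →
      ∫⁻ t in Ioo a b, ∫⁻ x, ‖curl (u t) x‖ₑ ^ 2 ≤ ENNReal.ofReal (K * Real.sqrt (b - a))) :
    ∃ M r₀ : ℝ, 0 < M ∧ 0 < r₀ ∧ ∀ s ∈ Ico (T / 2) T, ∀ (x : EuclideanSpace ℝ (Fin 3)),
      ∀ R ∈ Ioc 0 r₀, ∫⁻ y in ball x R, ‖u s y‖ₑ ^ 2 ≤ ENNReal.ofReal (M * R) := by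
  -- ### the unit-viscosity rescaling `v = α • stPull α 1 0 0 u`, `α = ν⁻¹`
  set α : ℝ := ν⁻¹ with hα
  have hαpos : 0 < α := inv_pos.2 hν
  have hαν : α * ν = 1 := by rw [hα, inv_mul_cancel₀ hν.ne']
  have hνα : ν * α = 1 := by rw [mul_comm, hαν]
  have hβeq : α = α * 1 := (mul_one α).symm
  set Sl : TopologicalSpace.Opens (ℝ × EuclideanSpace ℝ (Fin 3)) :=
    ⟨Ioo 0 T ×ˢ univ, isOpen_Ioo.prod isOpen_univ⟩ with hSldef
  have hSlsub : (Sl : Set (ℝ × EuclideanSpace ℝ (Fin 3))) ⊆ Ioo 0 T ×ˢ univ := Subset.rfl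
  set q : ℝ → EuclideanSpace ℝ (Fin 3) → ℝ := fun t x => p t x - (p t 0 - normalisedPressure (u t) 0)
    with hq
  have hsw : IsSuitableWeakSolutionOn (stPreimage α 1 0 0 Sl) 1 0 (α • stPull α 1 0 0 u)
      (α ^ 2 • stPull α 1 0 0 q) := by
    have h0 := (SereginSverak2002.isSuitableWeakSolutionOn_gauge_of_classical hν hT hsol hLH Sl
      hSlsub).stRescale hαpos one_pos hβeq 0 0
    have hvisc : α * ν / 1 = 1 := by rw [div_one, hαν]
    have hforce : ((α ^ 2 * 1) • stPull α 1 0 0 (0 : ℝ → EuclideanSpace ℝ (Fin 3) →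
        EuclideanSpace ℝ (Fin 3))) = 0 := by
      funext s y; simp [stPull]
    rw [hvisc, hforce] at h0
    exact h0
  have hGv : HasWeakSpatialGradientOn (stPreimage α 1 0 0 Sl) (α • stPull α 1 0 0 u)
      ((α * 1) • stPull α 1 0 0 fun t x => fderiv ℝ (u t) x) :=
    (hasWeakSpatialGradientOn_of_contDiffOn isOpen_Ioo hSlsub
      ((SereginSverak2002.classical_Ioo hsol).smooth_velocity.of_le (by norm_cast))).stRescale
      α hαpos one_pos 0 0
  -- cylinders `Q_ρ(τ, x)` with `ρ² ≤ τ ≤ ν T` lie in the rescaled slab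
  have hcyl : ∀ (τ ρ : ℝ) (x : EuclideanSpace ℝ (Fin 3)), ρ ^ 2 ≤ τ → τ ≤ ν * T →
      parabolicCylinder ρ ((τ, x) : ℝ × EuclideanSpace ℝ (Fin 3)) ⊆
        ((stPreimage α 1 0 0 Sl : TopologicalSpace.Opens (ℝ × EuclideanSpace ℝ (Fin 3))) :
          Set (ℝ × EuclideanSpace ℝ (Fin 3))) := by
    intro τ ρ x hρτ hτT w hw
    rw [mem_parabolicCylinder] at hw
    change stAffine α 1 0 0 w ∈ Ioo 0 T ×ˢ (univ : Set (EuclideanSpace ℝ (Fin 3)))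
    rw [mem_prod, stAffine_fst]
    have hw1 : 0 < w.1 := by nlinarith [hw.1.1, sq_nonneg ρ]
    have hw2 : α * w.1 < α * (ν * T) := mul_lt_mul_of_pos_left (lt_of_lt_of_le hw.1.2 hτT) hαpos
    have e : α * (ν * T) = T := by rw [← mul_assoc, hαν, one_mul]
    refine ⟨⟨by nlinarith [mul_pos hαpos hw1], by linarith⟩, mem_univ _⟩
  -- ### the constants
  set r₁ : ℝ := min 1 (Real.sqrt (ν * T / 2)) with hr₁
  have hr₁pos : 0 < r₁ := lt_min one_pos (Real.sqrt_pos.2 (by positivity))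
  have hr₁sq : r₁ ^ 2 ≤ ν * T / 2 := by
    have h1 : r₁ ≤ Real.sqrt (ν * T / 2) := min_le_right _ _
    have h2 := pow_le_pow_left₀ hr₁pos.le h1 2
    rwa [Real.sq_sqrt (by positivity)] at h2
  have hr₁0 : ENNReal.ofReal r₁ ≠ 0 := (ENNReal.ofReal_pos.2 hr₁pos).ne'
  set E₀ : ℝ := VectorCalculus.kineticEnergy (u 0) with hE₀
  set A₀e : ℝ≥0∞ := (ENNReal.ofReal r₁)⁻¹ * (‖α‖ₑ ^ 2 * ENNReal.ofReal (2 * E₀)) with hA₀e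
  have hA₀top : A₀e ≠ ⊤ := ENNReal.mul_ne_top (ENNReal.inv_ne_top.2 hr₁0)
    (ENNReal.mul_ne_top (by simp) ENNReal.ofReal_ne_top)
  set Pq : ℝ≥0∞ := ‖α ^ 2‖ₑ ^ (3 / 2 : ℝ) *
      ENNReal.ofReal (α * (1 : ℝ) ^ Module.finrank ℝ (EuclideanSpace ℝ (Fin 3)))⁻¹ *
      ∫⁻ z in Ioo 0 T ×ˢ (univ : Set (EuclideanSpace ℝ (Fin 3))), ‖q z.1 z.2‖ₑ ^ (3 / 2 : ℝ) with hPq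
  have hPqtop : Pq ≠ ⊤ :=
    ENNReal.mul_ne_top (ENNReal.mul_ne_top (ENNReal.rpow_ne_top_of_nonneg (by norm_num) enorm_ne_top)
      ENNReal.ofReal_ne_top) (SereginSverak2002.lintegral_slab_gauged_pressure_lt_top hν hT hsol hLH).ne
  set D₀e : ℝ≥0∞ := (ENNReal.ofReal r₁ ^ 2)⁻¹ * Pq with hD₀e
  have hD₀top : D₀e ≠ ⊤ := ENNReal.mul_ne_top (ENNReal.inv_ne_top.2 (pow_ne_zero _ hr₁0)) hPqtop
  set KE : ℝ := α * Real.sqrt α * K with hKE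
  have hKE0 : 0 ≤ KE := by positivity
  obtain ⟨KS, hKS⟩ :=
    Seregin2020.scaledEnergies_bounded_of_cknE_le_unif KE.toNNReal A₀e.toNNReal D₀e.toNNReal
  have hcont : ContinuousOn (uncurry u) (Ico 0 T ×ˢ (univ : Set (EuclideanSpace ℝ (Fin 3)))) :=
    SereginSverak2002.continuousOn_uncurry hsol
  -- un-zooming the slices: `‖ν‖ₑ² ‖v(s,y)‖ₑ² = ‖u(α s, y)‖ₑ²`
  have hunzoom : ∀ (s : ℝ) (y : EuclideanSpace ℝ (Fin 3)),
      ‖ν‖ₑ ^ 2 * ‖(α • stPull α 1 0 0 u) s y‖ₑ ^ 2 = ‖u (α * s) y‖ₑ ^ 2 := by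
    intro s y
    rw [← mul_pow, ← enorm_smul, smul_stPull_apply, smul_smul, hνα, one_smul, zero_add, zero_add,
      one_smul]
  have hν2 : ‖ν‖ₑ ^ 2 = ENNReal.ofReal (ν ^ 2) := by
    rw [Real.enorm_eq_ofReal hν.le, ENNReal.ofReal_pow hν.le]
  -- ### the claim
  refine ⟨ν ^ 2 * (KS : ℝ) + 1, r₁ / 2, by positivity, by positivity, ?_⟩
  intro s₀ hs₀ x R hR
  -- the top time of the cylinder, in rescaled units
  set τ : ℝ := min (ν * T) (ν * s₀ + R ^ 2 / 2) with hτ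
  have hτT : τ ≤ ν * T := min_le_left _ _
  have hτs : τ ≤ ν * s₀ + R ^ 2 / 2 := min_le_right _ _
  have hνs₀ : ν * (T / 2) ≤ ν * s₀ := mul_le_mul_of_nonneg_left hs₀.1 hν.le
  have hτ₁ : r₁ ^ 2 ≤ τ := le_min (by nlinarith [mul_pos hν hT]) (by nlinarith [sq_nonneg R])
  have hs₀τ : ν * s₀ < τ := lt_min (mul_lt_mul_of_pos_left hs₀.2 hν) (by nlinarith [hR.1])
  have hRr₁ : R ≤ r₁ := by linarith [hR.2]
  have hR0 : ENNReal.ofReal R ≠ 0 := (ENNReal.ofReal_pos.2 hR.1).ne'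
  set z : ℝ × EuclideanSpace ℝ (Fin 3) := (τ, x) with hz
  have hzsub := hcyl τ r₁ x hτ₁ hτT
  -- (i) the top-scale energy bound `A(r₁) ≤ A₀`
  have hA : cknAEss r₁ z (α • stPull α 1 0 0 u) ≤ A₀e := by
    unfold cknAEss
    refine essSup_le_of_ae_le _ ?_
    filter_upwards [ae_restrict_mem measurableSet_Ioo] with s hs
    have hs' : z.1 - r₁ ^ 2 < s ∧ s < z.1 := hs
    have hs0 : 0 < s := by simp only [hz] at hs'; linarith [hs'.1]
    have hsT : α * s ∈ Icc 0 T := by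
      refine ⟨by positivity, ?_⟩
      have h1 : α * s ≤ α * (ν * T) :=
        mul_le_mul_of_nonneg_left ((show s < τ by simpa [hz] using hs'.2).le.trans hτT) hαpos.le
      rw [← mul_assoc, hαν, one_mul] at h1
      exact h1
    refine mul_le_mul' le_rfl ?_
    calc ∫⁻ y in ball z.2 r₁, ‖(α • stPull α 1 0 0 u) s y‖ₑ ^ 2
        = ∫⁻ y in ball z.2 r₁, ‖α‖ₑ ^ 2 * ‖u (α * s) y‖ₑ ^ 2 := by
          refine lintegral_congr fun y => ?_
          rw [smul_stPull_apply, enorm_smul, mul_pow, zero_add, zero_add, one_smul]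
      _ = ‖α‖ₑ ^ 2 * ∫⁻ y in ball z.2 r₁, ‖u (α * s) y‖ₑ ^ 2 := by
          rw [lintegral_const_mul' _ _ (by simp)]
      _ ≤ ‖α‖ₑ ^ 2 * ∫⁻ y, ‖u (α * s) y‖ₑ ^ 2 := mul_le_mul' le_rfl (setLIntegral_le_lintegral _ _)
      _ ≤ ‖α‖ₑ ^ 2 * ENNReal.ofReal (2 * E₀) :=
          mul_le_mul' le_rfl (hLH.lintegral_enorm_sq_le hν.le hsT)
  -- (ii) the top-scale pressure bound `D(r₁) ≤ D₀` (global `L^{3/2}` budget of the gauged pressure)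
  have hD : cknD r₁ z (α ^ 2 • stPull α 1 0 0 q) ≤ D₀e := by
    unfold cknD
    refine mul_le_mul' le_rfl ?_
    calc ∫⁻ w in parabolicCylinder r₁ z, ‖(α ^ 2 • stPull α 1 0 0 q) w.1 w.2‖ₑ ^ (3 / 2 : ℝ)
        ≤ ∫⁻ w in stAffine α 1 0 0 ⁻¹' (Ioo 0 T ×ˢ (univ : Set (EuclideanSpace ℝ (Fin 3)))),
            ‖(α ^ 2 • stPull α 1 0 0 q) w.1 w.2‖ₑ ^ (3 / 2 : ℝ) :=
          lintegral_mono_set hzsub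
      _ = Pq := by
          rw [hPq, setLIntegral_enorm_rpow_stRescale hαpos one_pos 0 0 (α ^ 2) q _ (by norm_num)]
  -- (iii) the scaled dissipation `E(r) ≤ KE` on every sub-scale, from the window law
  have hE : ∀ r ∈ Ioc (0 : ℝ) r₁,
      cknE r z ((α * 1) • stPull α 1 0 0 fun t x => fderiv ℝ (u t) x) ≤ ENNReal.ofReal KE := by
    intro r hr
    refine HolderBridge.cknE_le_of_lintegral_le z hr.1 ?_
    have hr2τ : r ^ 2 ≤ τ := (pow_le_pow_left₀ hr.1.le hr.2 2).trans hτ₁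
    have ha : 0 ≤ α * (τ - r ^ 2) := mul_nonneg hαpos.le (sub_nonneg.2 hr2τ)
    have hab : α * (τ - r ^ 2) ≤ α * τ := by nlinarith [sq_nonneg r]
    have hb : α * τ ≤ T := by
      have h1 : α * τ ≤ α * (ν * T) := mul_le_mul_of_nonneg_left hτT hαpos.le
      rwa [← mul_assoc, hαν, one_mul] at h1
    -- the cylinder is the preimage of the physical cylinder `(α(τ - r²), ατ) × B(x, r)`
    have hpre : stAffine α 1 0 0 ⁻¹'
        (Ioo (α * (τ - r ^ 2)) (α * τ) ×ˢ ball x r) = parabolicCylinder r z := by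
      ext w
      simp only [mem_preimage, mem_prod, stAffine_fst, stAffine_snd, mem_parabolicCylinder, mem_Ioo,
        mem_ball, zero_add, one_smul, hz]
      constructor
      · rintro ⟨⟨h1, h2⟩, h3⟩
        exact ⟨⟨by nlinarith, lt_of_mul_lt_mul_left h2 hαpos.le⟩, h3⟩
      · rintro ⟨⟨h1, h2⟩, h3⟩
        exact ⟨⟨by nlinarith, mul_lt_mul_of_pos_left h2 hαpos⟩, h3⟩
    have hwin_cyl := HolderBridge.lintegral_cylinder_frobeniusNormSq_le_of_window hν hsol hLH ha hb
      (hwin _ _ ha hab hb) (ball x r)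
    rw [← hpre, setLIntegral_frobeniusNormSq_stRescale hαpos one_pos 0 0 (α * 1)
      (fun t x => fderiv ℝ (u t) x) _]
    refine (mul_le_mul' le_rfl hwin_cyl).trans (le_of_eq ?_)
    rw [show α * τ - α * (τ - r ^ 2) = α * r ^ 2 by ring, Real.sqrt_mul hαpos.le,
      Real.sqrt_sq hr.1.le, mul_one, one_pow, mul_one,
      ← ENNReal.ofReal_mul (sq_nonneg _), ← ENNReal.ofReal_mul (by positivity)]
    congr 1
    rw [hKE]
    field_simp
  -- (iv) Seregin's centre-uniform Morrey estimate at the centre `z`, radius `r₁`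
  have hS := hKS _ _ _ _ hsw hGv z r₁ hr₁pos hzsub
    (hA.trans (ENNReal.coe_toNNReal hA₀top).symm.le) (hD.trans (ENNReal.coe_toNNReal hD₀top).symm.le)
    (fun r hr => (hE r hr).trans (le_of_eq rfl)) R ⟨hR.1, hR.2⟩
  have hAR : cknAEss R z (α • stPull α 1 0 0 u) ≤ KS :=
    le_trans (le_trans (le_trans le_self_add le_self_add) le_self_add) hS
  -- (v) a.e. slice bound for `u` on `(α(τ - R²), ατ)`
  have hae : ∀ᵐ s ∂(volume.restrict (Ioo (τ - R ^ 2) τ)),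
      ∫⁻ y in ball x R, ‖u (α * s) y‖ₑ ^ 2 ≤ ENNReal.ofReal (ν ^ 2) * (ENNReal.ofReal R * KS) := by
    have h1 := ENNReal.ae_le_essSup (μ := volume.restrict (Ioo (z.1 - R ^ 2) z.1))
      (fun t => (ENNReal.ofReal R)⁻¹ * ∫⁻ y in ball z.2 R, ‖(α • stPull α 1 0 0 u) t y‖ₑ ^ 2)
    have h1' : ∀ᵐ s ∂(volume.restrict (Ioo (z.1 - R ^ 2) z.1)),
        (ENNReal.ofReal R)⁻¹ * ∫⁻ y in ball z.2 R, ‖(α • stPull α 1 0 0 u) s y‖ₑ ^ 2 ≤ KS :=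
      h1.mono fun s hs => hs.trans hAR
    simp only [hz] at h1'
    filter_upwards [h1'] with s hs
    have hI : ∫⁻ y in ball x R, ‖(α • stPull α 1 0 0 u) s y‖ₑ ^ 2 ≤ ENNReal.ofReal R * KS := by
      calc ∫⁻ y in ball x R, ‖(α • stPull α 1 0 0 u) s y‖ₑ ^ 2
          = ENNReal.ofReal R * ((ENNReal.ofReal R)⁻¹ *
              ∫⁻ y in ball x R, ‖(α • stPull α 1 0 0 u) s y‖ₑ ^ 2) := by
            rw [← mul_assoc, ENNReal.mul_inv_cancel hR0 ENNReal.ofReal_ne_top, one_mul]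
        _ ≤ ENNReal.ofReal R * KS := mul_le_mul' le_rfl hs
    calc ∫⁻ y in ball x R, ‖u (α * s) y‖ₑ ^ 2
        = ∫⁻ y in ball x R, ‖ν‖ₑ ^ 2 * ‖(α • stPull α 1 0 0 u) s y‖ₑ ^ 2 :=
          lintegral_congr fun y => (hunzoom s y).symm
      _ = ‖ν‖ₑ ^ 2 * ∫⁻ y in ball x R, ‖(α • stPull α 1 0 0 u) s y‖ₑ ^ 2 :=
          lintegral_const_mul' _ _ (by simp)
      _ ≤ ENNReal.ofReal (ν ^ 2) * (ENNReal.ofReal R * KS) := by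
          rw [hν2]; exact mul_le_mul' le_rfl hI
  -- (vi) back to physical time `t = α s`
  have e1 : (0 : ℝ) + ν * (α * (τ - R ^ 2)) = τ - R ^ 2 := by rw [← mul_assoc, hνα, one_mul, zero_add]
  have e2 : (0 : ℝ) + ν * (α * τ) = τ := by rw [← mul_assoc, hνα, one_mul, zero_add]
  have hae' : ∀ᵐ s ∂(volume.restrict (Ioo (0 + ν * (α * (τ - R ^ 2))) (0 + ν * (α * τ)))),
      ∫⁻ y in ball x R, ‖u (α * s) y‖ₑ ^ 2 ≤ ENNReal.ofReal (ν ^ 2) * (ENNReal.ofReal R * KS) := by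
    rw [e1, e2]; exact hae
  have hphys := ae_restrict_Ioo_comp_time_affine hν 0 (α * (τ - R ^ 2)) (α * τ) hae'
  have hphys' : ∀ᵐ t ∂(volume.restrict (Ioo (α * (τ - R ^ 2)) (α * τ))),
      ∫⁻ y in ball x R, ‖u t y‖ₑ ^ 2 ≤ ENNReal.ofReal (ν ^ 2) * (ENNReal.ofReal R * KS) := by
    filter_upwards [hphys] with t ht
    have e3 : α * (0 + ν * t) = t := by rw [zero_add, ← mul_assoc, hαν, one_mul]
    rwa [e3] at ht
  -- (vii) every time of the window, in particular `s₀`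
  have hsub : Ioo (α * (τ - R ^ 2)) (α * τ) ⊆ Ico 0 T := by
    intro t ht
    have hR2τ : R ^ 2 ≤ τ := (pow_le_pow_left₀ hR.1.le hRr₁ 2).trans hτ₁
    have h0 : 0 ≤ α * (τ - R ^ 2) := mul_nonneg hαpos.le (sub_nonneg.2 hR2τ)
    have h1 : α * τ ≤ α * (ν * T) := mul_le_mul_of_nonneg_left hτT hαpos.le
    rw [← mul_assoc, hαν, one_mul] at h1
    exact ⟨h0.trans ht.1.le, lt_of_lt_of_le ht.2 h1⟩
  have hs₀mem : s₀ ∈ Ioo (α * (τ - R ^ 2)) (α * τ) := by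
    constructor
    · have h1 : α * (τ - R ^ 2) < α * (ν * s₀) :=
        mul_lt_mul_of_pos_left (by nlinarith [hR.1]) hαpos
      rwa [← mul_assoc, hαν, one_mul] at h1
    · have h1 : α * (ν * s₀) < α * τ := mul_lt_mul_of_pos_left hs₀τ hαpos
      rwa [← mul_assoc, hαν, one_mul] at h1
  have hfin := setLIntegral_ball_sq_le_of_ae hcont hsub hphys' s₀ hs₀mem
  refine hfin.trans ?_
  rw [← ENNReal.ofReal_coe_nnreal, ← ENNReal.ofReal_mul hR.1.le, ← ENNReal.ofReal_mul (sq_nonneg _)]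
  refine ENNReal.ofReal_le_ofReal ?_
  have hKS0 : 0 ≤ (KS : ℝ) := KS.2
  nlinarith [hR.1]

/-! ### `UniformLocalTypeI` (unfolded) from the window law -/

/-- **Window law ⇒ `UniformLocalTypeI T u`** (the Cruxes-local predicate S1 of
`Cruxes/EnstrophyQuarterLaw/Lines/sparse_sieve.lean`, UNFOLDED VERBATIM): a classical solution on `[0, T)`
(`ν, T > 0`), Leray–Hopf on `[0, T]` from a rapidly decaying datum, with the energy `½`-Hölder window law
`∫_a^b ∫ |curl u|² ≤ K √(b − a)` (`0 ≤ a ≤ b ≤ T`) is uniformly locally Type I in the CKN quantities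
`A` (`R⁻¹ ∫_{B_R(x)} |u(s)|² ≤ M` for all `s < T`, `x`, `0 < R ≤ r₀`: late times by
`energy_ball_le_of_window`, early times `s < T/2` by the sub-slab sup bound `bounded_subslab_of_lerayHopf`)
and `E` (`∫_{b−R²}^{b} ∫_{B_R(x)} ‖∇u‖² ≤ M R`: `dissipation_cylinder_le_of_window`).
[cite: Seregin2006, Lemma 2.1 (a) (arXiv:math/0607537 §2); AlbrittonBarker2019, Lemma 2.6] -/
theorem uniformLocalTypeI_of_window (hν : 0 < ν) (hT : 0 < T)
    (hsol : IsClassicalNSSolutionOn (Ico 0 T) ν 0 u p) (hLH : IsLerayHopfOn T ν 0 (u 0) u)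
    (hdec : HasRapidSpatialDecay (u 0)) {K : ℝ}
    (hwin : ∀ a b : ℝ, 0 ≤ a → a ≤ b → b ≤ T →
      ∫⁻ t in Ioo a b, ∫⁻ x, ‖curl (u t) x‖ₑ ^ 2 ≤ ENNReal.ofReal (K * Real.sqrt (b - a))) :
    ∃ M r₀ : ℝ, 0 < M ∧ 0 < r₀ ∧
      (∀ s ∈ Set.Ico 0 T, ∀ (x : EuclideanSpace ℝ (Fin 3)), ∀ R ∈ Set.Ioc 0 r₀,
        ∫⁻ y in Metric.ball x R, ‖u s y‖ₑ ^ 2 ≤ ENNReal.ofReal (M * R)) ∧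
      (∀ b ∈ Set.Ioc 0 T, ∀ (x : EuclideanSpace ℝ (Fin 3)), ∀ R ∈ Set.Ioc 0 r₀, R ^ 2 ≤ b →
        ∫⁻ t in Set.Ioo (b - R ^ 2) b, ∫⁻ y in Metric.ball x R, ‖fderiv ℝ (u t) y‖ₑ ^ 2 ≤
          ENNReal.ofReal (M * R)) := by
  -- the window law with a non-negative constant
  set K' : ℝ := max K 0 with hK'
  have hK'0 : 0 ≤ K' := le_max_right _ _
  have hwin' : ∀ a b : ℝ, 0 ≤ a → a ≤ b → b ≤ T →
      ∫⁻ t in Ioo a b, ∫⁻ x, ‖curl (u t) x‖ₑ ^ 2 ≤ ENNReal.ofReal (K' * Real.sqrt (b - a)) :=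
    fun a b ha hab hb => (hwin a b ha hab hb).trans (ENNReal.ofReal_le_ofReal
      (mul_le_mul_of_nonneg_right (le_max_left _ _) (Real.sqrt_nonneg _)))
  obtain ⟨M₁, r₁, hM₁, hr₁, hA⟩ := energy_ball_le_of_window hν hT hsol hLH hK'0 hwin'
  obtain ⟨V, hV⟩ := bounded_subslab_of_lerayHopf hν hsol hLH hdec (T / 2) ⟨by positivity, by linarith⟩
  set c₁ : ℝ := (volume (ball (0 : EuclideanSpace ℝ (Fin 3)) 1)).toReal with hc₁
  have hc₁0 : 0 ≤ c₁ := ENNReal.toReal_nonneg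
  set M : ℝ := M₁ + K' + V ^ 2 * c₁ * r₁ ^ 2 + 1 with hM
  have hVc : 0 ≤ V ^ 2 * c₁ * r₁ ^ 2 := by positivity
  have hM₁M : M₁ ≤ M := by rw [hM]; linarith
  have hK'M : K' ≤ M := by rw [hM]; linarith
  have hVM : V ^ 2 * c₁ * r₁ ^ 2 ≤ M := by rw [hM]; linarith
  refine ⟨M, r₁, by rw [hM]; linarith, hr₁, ?_, ?_⟩
  · intro s hs x R hR
    by_cases hsT : T / 2 ≤ s
    · exact (hA s ⟨hsT, hs.2⟩ x R hR).trans
        (ENNReal.ofReal_le_ofReal (mul_le_mul_of_nonneg_right hM₁M hR.1.le))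
    · have hsI : s ∈ Icc 0 (T / 2) := ⟨hs.1, (not_le.1 hsT).le⟩
      exact (setLIntegral_ball_sq_le_of_bound hR.1 hR.2 (fun y _ => hV s hsI y)).trans
        (ENNReal.ofReal_le_ofReal (mul_le_mul_of_nonneg_right hVM hR.1.le))
  · intro b hb x R hR hRb
    exact (dissipation_cylinder_le_of_window hν hsol hLH hwin' hb.2 x hR.1 hRb).trans
      (ENNReal.ofReal_le_ofReal (mul_le_mul_of_nonneg_right hK'M hR.1.le))

/-! ### By name: the cruxes `EnergyHalfHolder` / `EnstrophyQuarterLaw` imply stub S1 -/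

/-- **`EnergyHalfHolder ⇒ stub_uniformLocalTypeI`** — the crux of route `HalfHolderEnergy`
(stmt-NavierStokesRegularity-25161, the window quarter law) implies the registered stub S1
`stub_uniformLocalTypeI` of the 1574 skeleton of record `Lines/sparse_sieve.lean` (signature verbatim, the
Cruxes-local `UniformLocalTypeI T u` unfolded): the line's "OPEN, XL" first stub is a NO-LOSS cut. A
conditional implication between OPEN statements; nothing about either is asserted. [folklore] -/
theorem uniformLocalTypeI_of_energyHalfHolder
    (hH : Summit.NavierStokesRegularity.NavierStokesRegularity.Theses.HalfHolderEnergy.EnergyHalfHolder) :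
    ∀ (ν T : ℝ), 0 < ν → 0 < T →
    ∀ (u : ℝ → EuclideanSpace ℝ (Fin 3) → EuclideanSpace ℝ (Fin 3))
      (p : ℝ → EuclideanSpace ℝ (Fin 3) → ℝ),
    IsMaximalSmoothSolution ν 0 u p T → IsLerayHopfOn T ν 0 (u 0) u →
    HasRapidSpatialDecay (u 0) →
    ∃ M r₀ : ℝ, 0 < M ∧ 0 < r₀ ∧
      (∀ s ∈ Set.Ico 0 T, ∀ (x : EuclideanSpace ℝ (Fin 3)), ∀ R ∈ Set.Ioc 0 r₀,
        ∫⁻ y in Metric.ball x R, ‖u s y‖ₑ ^ 2 ≤ ENNReal.ofReal (M * R)) ∧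
      (∀ b ∈ Set.Ioc 0 T, ∀ (x : EuclideanSpace ℝ (Fin 3)), ∀ R ∈ Set.Ioc 0 r₀, R ^ 2 ≤ b →
        ∫⁻ t in Set.Ioo (b - R ^ 2) b, ∫⁻ y in Metric.ball x R, ‖fderiv ℝ (u t) y‖ₑ ^ 2 ≤
          ENNReal.ofReal (M * R)) := by
  intro ν T hν hT u p hmax hLH hdec
  obtain ⟨K, hK⟩ := hH ν T hν hT u p hmax hLH hdec
  exact uniformLocalTypeI_of_window hν hT hmax.1 hLH hdec hK

/-- **`EnstrophyQuarterLaw ⇒ stub_uniformLocalTypeI`** — the shelf crux (stmt-NavierStokesRegularity-1574)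
implies stub S1 of its own skeleton of record (signature verbatim, `UniformLocalTypeI` unfolded), through
the landed converter `energyHalfHolder_of_enstrophyQuarterLaw` (EQL ⇒ HHE). So `UniformLocalTypeI` is
IMPLIED by the crux it serves: half of the card's characterisation
`EnstrophyQuarterLaw ⟺ NoTypeII ∧ UniformLocalTypeI ∧ UniformSparseness`. Conditional edge only. [folklore] -/
theorem uniformLocalTypeI_of_enstrophyQuarterLaw
    (hQ : Summit.NavierStokesRegularity.NavierStokesRegularity.Theses.StretchingWellBinding.EnstrophyQuarterLaw) :
    ∀ (ν T : ℝ), 0 < ν → 0 < T →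
    ∀ (u : ℝ → EuclideanSpace ℝ (Fin 3) → EuclideanSpace ℝ (Fin 3))
      (p : ℝ → EuclideanSpace ℝ (Fin 3) → ℝ),
    IsMaximalSmoothSolution ν 0 u p T → IsLerayHopfOn T ν 0 (u 0) u →
    HasRapidSpatialDecay (u 0) →
    ∃ M r₀ : ℝ, 0 < M ∧ 0 < r₀ ∧
      (∀ s ∈ Set.Ico 0 T, ∀ (x : EuclideanSpace ℝ (Fin 3)), ∀ R ∈ Set.Ioc 0 r₀,
        ∫⁻ y in Metric.ball x R, ‖u s y‖ₑ ^ 2 ≤ ENNReal.ofReal (M * R)) ∧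
      (∀ b ∈ Set.Ioc 0 T, ∀ (x : EuclideanSpace ℝ (Fin 3)), ∀ R ∈ Set.Ioc 0 r₀, R ^ 2 ≤ b →
        ∫⁻ t in Set.Ioo (b - R ^ 2) b, ∫⁻ y in Metric.ball x R, ‖fderiv ℝ (u t) y‖ₑ ^ 2 ≤
          ENNReal.ofReal (M * R)) :=
  uniformLocalTypeI_of_energyHalfHolder
    (Summit.NavierStokesRegularity.NavierStokesRegularity.Theorems.energyHalfHolder_of_enstrophyQuarterLaw hQ)

end Summit.NavierStokesRegularity.NavierStokesRegularity.Theorems.EnstrophyQuarterLaw.LocalTypeI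

end
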